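import Mathlib
import HarnessLib
import Summits.ValiantsHypothesis.ValiantsHypothesis.Theorems.LacunarySymmetroidMatrixDescartesOsculationLawUniformFinite

/-!
# ValiantsHypothesis / LacunarySymmetroid — crux `MatrixDescartes` (stmt-ValiantsHypothesis-18050, V1),
# line «osculation-law»: UNIFORM columns, part 8 — the `ℝ[t][b]` DICTIONARY for an ARBITRARY bivariate polynomial,
# finiteness of its osculation-type set from a resultant, and invariance under constant factors

For any `Φ : MvPolynomial (Fin 2) ℝ` write `toBiv Φ := MvPolynomial.aeval ![C X, X] Φ ∈ ℝ[X][X]` (INLINE, no definition;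
outer variable `b = X₁`, coefficients polynomials in `t = X₀`; the dictionary of val-lit-p7 g13's staged
`GPGenericResultant` note, `evalEval_aeval_CX_Y`).  Then `((toBiv Φ).map (evalRingHom t)).eval b = eval ![t,b] Φ`
(`eval_map_toBiv`), so part 7's abstract finiteness criterion applies to the set
`{t > 0, b > 0, Φ = 0, H(Φ) = 0}` of ANY `Φ` (`mv_osc_finite_of_resultant_ne_zero`: `Res_b(toBiv Φ, toBiv H(Φ)) ≢ 0` and no
identically vanishing fibre ⇒ finite) — e.g. the node-2 curve `det(G(t) − c tᴺ + b·B)` of the `stub_recursion` lane, which is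
not an `insertionPoly`.  Also `H(C κ · Φ) = C κ³ · H(Φ)` (`logHessian_C_mul`) and the resulting invariance of the set under a
nonzero constant factor (`osc_set_C_mul`), which is the `det(Y)⁻²` between a congruent pencil and its polynomial model.

Honest framing: helper layer of an UNREGISTERED V1 law line (tools for the general-position density discussion of
`stub_recursion`); `stub_osculationLaw` (LAW), `stub_recursion`, `MatrixDescartes`, Conjecture B, `VP ≠ VNP` are OPEN / NOT
proved.  No definitions, no named facts; Mathlib + tree files.
-/

-- `Summit.ValiantsHypothesis.ValiantsHypothesis.…` is the tree's mandated single-conjunct layout (Sub = Summit).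
set_option linter.dupNamespace false

noncomputable section

namespace Summit.ValiantsHypothesis.ValiantsHypothesis.Theorems.LacunarySymmetroidMatrixDescartes

namespace OsculationUniform

open Polynomial Set
open scoped BigOperators

/-! ### The dictionary `MvPolynomial (Fin 2) ℝ → ℝ[X][X]` -/

/-- **Dictionary.**  Specialising the `t`-coefficients of `toBiv Φ` at `t` and evaluating at `b` is evaluating `Φ` at
`(t, b)`. [folklore] -/
theorem eval_map_toBiv (Φ : MvPolynomial (Fin 2) ℝ) (t b : ℝ) :
    ((MvPolynomial.aeval (![Polynomial.C Polynomial.X, Polynomial.X] : Fin 2 → ℝ[X][X]) Φ).map (evalRingHom t)).eval b =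
      MvPolynomial.eval ![t, b] Φ := by
  -- both sides are ring homomorphisms in `Φ`; compare them on generators
  set F : MvPolynomial (Fin 2) ℝ →+* ℝ :=
    (evalRingHom b).comp ((mapRingHom (evalRingHom t)).comp
      (MvPolynomial.aeval (![Polynomial.C Polynomial.X, Polynomial.X] : Fin 2 → ℝ[X][X])).toRingHom) with hF
  have hFG : F = MvPolynomial.eval ![t, b] := by
    refine MvPolynomial.ringHom_ext (fun a => ?_) (fun i => ?_)
    · simp [hF]
    · fin_cases i <;> simp [hF]
  have := congr_arg (fun φ : MvPolynomial (Fin 2) ℝ →+* ℝ => φ Φ) hFG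
  simpa [hF] using this

/-- The same with a point `p : Fin 2 → ℝ`. [folklore] -/
theorem eval_map_toBiv' (Φ : MvPolynomial (Fin 2) ℝ) (p : Fin 2 → ℝ) :
    ((MvPolynomial.aeval (![Polynomial.C Polynomial.X, Polynomial.X] : Fin 2 → ℝ[X][X]) Φ).map (evalRingHom (p 0))).eval (p 1) =
      MvPolynomial.eval p Φ := by
  rw [eval_map_toBiv, vec2_eq]

/-! ### Finiteness of `{Φ = 0, H(Φ) = 0}` in the open quadrant for an arbitrary `Φ` -/

/-- **Finiteness from the resultant, arbitrary bivariate `Φ`.**  If `Res_b(toBiv Φ, toBiv H(Φ)) ≢ 0` and no fibre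
`Φ(t,·)`, `t > 0`, vanishes identically, the set `{t > 0, b > 0, Φ = 0, H(Φ) = 0}` is finite.
[cite: GathenGerhard1999, Lemma 6.25] -/
theorem mv_osc_finite_of_resultant_ne_zero (Φ : MvPolynomial (Fin 2) ℝ)
    (hres : resultant (MvPolynomial.aeval (![Polynomial.C Polynomial.X, Polynomial.X] : Fin 2 → ℝ[X][X]) Φ)
      (MvPolynomial.aeval (![Polynomial.C Polynomial.X, Polynomial.X] : Fin 2 → ℝ[X][X])
        (MvPolynomial.X 0 * MvPolynomial.pderiv 0 (MvPolynomial.X 0 * MvPolynomial.pderiv 0 Φ)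
            * (MvPolynomial.X 1 * MvPolynomial.pderiv 1 Φ) ^ 2
          - 2 * (MvPolynomial.X 0 * MvPolynomial.pderiv 0 (MvPolynomial.X 1 * MvPolynomial.pderiv 1 Φ))
            * (MvPolynomial.X 0 * MvPolynomial.pderiv 0 Φ) * (MvPolynomial.X 1 * MvPolynomial.pderiv 1 Φ)
          + MvPolynomial.X 1 * MvPolynomial.pderiv 1 (MvPolynomial.X 1 * MvPolynomial.pderiv 1 Φ)
            * (MvPolynomial.X 0 * MvPolynomial.pderiv 0 Φ) ^ 2)) ≠ 0)
    (hvert : ∀ t : ℝ, 0 < t →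
      (MvPolynomial.aeval (![Polynomial.C Polynomial.X, Polynomial.X] : Fin 2 → ℝ[X][X]) Φ).map (evalRingHom t) ≠ 0) :
    {p : Fin 2 → ℝ | 0 < p 0 ∧ 0 < p 1 ∧ MvPolynomial.eval p Φ = 0 ∧
      MvPolynomial.eval p
        (MvPolynomial.X 0 * MvPolynomial.pderiv 0 (MvPolynomial.X 0 * MvPolynomial.pderiv 0 Φ)
            * (MvPolynomial.X 1 * MvPolynomial.pderiv 1 Φ) ^ 2
          - 2 * (MvPolynomial.X 0 * MvPolynomial.pderiv 0 (MvPolynomial.X 1 * MvPolynomial.pderiv 1 Φ))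
            * (MvPolynomial.X 0 * MvPolynomial.pderiv 0 Φ) * (MvPolynomial.X 1 * MvPolynomial.pderiv 1 Φ)
          + MvPolynomial.X 1 * MvPolynomial.pderiv 1 (MvPolynomial.X 1 * MvPolynomial.pderiv 1 Φ)
            * (MvPolynomial.X 0 * MvPolynomial.pderiv 0 Φ) ^ 2) = 0}.Finite := by
  refine osc_finite_of_resultant_ne_zero _ _ _ (fun p => ?_) hres hvert
  rw [Set.mem_setOf_eq, IsRoot, IsRoot, eval_map_toBiv', eval_map_toBiv']

/-! ### Constant factors -/

/-- `θ_i (C κ · Ψ) = C κ · θ_i Ψ`. [folklore] -/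
theorem euler_C_mul (κ : ℝ) (i : Fin 2) (Ψ : MvPolynomial (Fin 2) ℝ) :
    MvPolynomial.X i * MvPolynomial.pderiv i (MvPolynomial.C κ * Ψ) = MvPolynomial.C κ * (MvPolynomial.X i * MvPolynomial.pderiv i Ψ) := by
  rw [Derivation.leibniz, MvPolynomial.pderiv_C, smul_zero, add_zero, smul_eq_mul]
  ring

/-- **`H(C κ · Φ) = C κ³ · H(Φ)`**: the bordered log-Hessian is cubic in `Φ`. [folklore] -/
theorem logHessian_C_mul (κ : ℝ) (Φ : MvPolynomial (Fin 2) ℝ) :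
    MvPolynomial.X 0 * MvPolynomial.pderiv 0 (MvPolynomial.X 0 * MvPolynomial.pderiv 0 (MvPolynomial.C κ * Φ))
        * (MvPolynomial.X 1 * MvPolynomial.pderiv 1 (MvPolynomial.C κ * Φ)) ^ 2
      - 2 * (MvPolynomial.X 0 * MvPolynomial.pderiv 0 (MvPolynomial.X 1 * MvPolynomial.pderiv 1 (MvPolynomial.C κ * Φ)))
        * (MvPolynomial.X 0 * MvPolynomial.pderiv 0 (MvPolynomial.C κ * Φ)) * (MvPolynomial.X 1 * MvPolynomial.pderiv 1 (MvPolynomial.C κ * Φ))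
      + MvPolynomial.X 1 * MvPolynomial.pderiv 1 (MvPolynomial.X 1 * MvPolynomial.pderiv 1 (MvPolynomial.C κ * Φ))
        * (MvPolynomial.X 0 * MvPolynomial.pderiv 0 (MvPolynomial.C κ * Φ)) ^ 2 =
    MvPolynomial.C κ ^ 3 *
      (MvPolynomial.X 0 * MvPolynomial.pderiv 0 (MvPolynomial.X 0 * MvPolynomial.pderiv 0 Φ)
          * (MvPolynomial.X 1 * MvPolynomial.pderiv 1 Φ) ^ 2
        - 2 * (MvPolynomial.X 0 * MvPolynomial.pderiv 0 (MvPolynomial.X 1 * MvPolynomial.pderiv 1 Φ))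
          * (MvPolynomial.X 0 * MvPolynomial.pderiv 0 Φ) * (MvPolynomial.X 1 * MvPolynomial.pderiv 1 Φ)
        + MvPolynomial.X 1 * MvPolynomial.pderiv 1 (MvPolynomial.X 1 * MvPolynomial.pderiv 1 Φ)
          * (MvPolynomial.X 0 * MvPolynomial.pderiv 0 Φ) ^ 2) := by
  rw [euler_C_mul κ 0 Φ, euler_C_mul κ 1 Φ, euler_C_mul κ 0 (MvPolynomial.X 0 * MvPolynomial.pderiv 0 Φ),
    euler_C_mul κ 0 (MvPolynomial.X 1 * MvPolynomial.pderiv 1 Φ), euler_C_mul κ 1 (MvPolynomial.X 1 * MvPolynomial.pderiv 1 Φ)]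
  ring

/-- **Invariance of the osculation-type set under a nonzero constant factor.** [folklore] -/
theorem osc_set_C_mul (κ : ℝ) (hκ : κ ≠ 0) (Φ : MvPolynomial (Fin 2) ℝ) :
    {p : Fin 2 → ℝ | 0 < p 0 ∧ 0 < p 1 ∧ MvPolynomial.eval p (MvPolynomial.C κ * Φ) = 0 ∧
      MvPolynomial.eval p
        (MvPolynomial.X 0 * MvPolynomial.pderiv 0 (MvPolynomial.X 0 * MvPolynomial.pderiv 0 (MvPolynomial.C κ * Φ))
            * (MvPolynomial.X 1 * MvPolynomial.pderiv 1 (MvPolynomial.C κ * Φ)) ^ 2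
          - 2 * (MvPolynomial.X 0 * MvPolynomial.pderiv 0 (MvPolynomial.X 1 * MvPolynomial.pderiv 1 (MvPolynomial.C κ * Φ)))
            * (MvPolynomial.X 0 * MvPolynomial.pderiv 0 (MvPolynomial.C κ * Φ)) * (MvPolynomial.X 1 * MvPolynomial.pderiv 1 (MvPolynomial.C κ * Φ))
          + MvPolynomial.X 1 * MvPolynomial.pderiv 1 (MvPolynomial.X 1 * MvPolynomial.pderiv 1 (MvPolynomial.C κ * Φ))
            * (MvPolynomial.X 0 * MvPolynomial.pderiv 0 (MvPolynomial.C κ * Φ)) ^ 2) = 0} =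
    {p : Fin 2 → ℝ | 0 < p 0 ∧ 0 < p 1 ∧ MvPolynomial.eval p Φ = 0 ∧
      MvPolynomial.eval p
        (MvPolynomial.X 0 * MvPolynomial.pderiv 0 (MvPolynomial.X 0 * MvPolynomial.pderiv 0 Φ)
            * (MvPolynomial.X 1 * MvPolynomial.pderiv 1 Φ) ^ 2
          - 2 * (MvPolynomial.X 0 * MvPolynomial.pderiv 0 (MvPolynomial.X 1 * MvPolynomial.pderiv 1 Φ))
            * (MvPolynomial.X 0 * MvPolynomial.pderiv 0 Φ) * (MvPolynomial.X 1 * MvPolynomial.pderiv 1 Φ)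
          + MvPolynomial.X 1 * MvPolynomial.pderiv 1 (MvPolynomial.X 1 * MvPolynomial.pderiv 1 Φ)
            * (MvPolynomial.X 0 * MvPolynomial.pderiv 0 Φ) ^ 2) = 0} := by
  ext p
  simp only [Set.mem_setOf_eq, logHessian_C_mul, map_mul, map_pow, MvPolynomial.eval_C, mul_eq_zero, hκ,
    pow_eq_zero_iff, ne_eq, OfNat.ofNat_ne_zero, not_false_eq_true, false_or]

end OsculationUniform

end Summit.ValiantsHypothesis.ValiantsHypothesis.Theorems.LacunarySymmetroidMatrixDescartes
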